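import Literature.MathematicalPhysics.QuantumLattice.TorusPairSusceptibility
import Literature.MathematicalPhysics.QuantumLattice.FockMapOp
import HarnessLib

/-!
# Symmetries of the inter-cluster second-order kernel: gauge covariance, cluster exchange and
# covariance under second-quantised orbital bijections

Topic `MathematicalPhysics/QuantumLattice`; continues the story of `ClusterPairBosonCouplings.lean`
(Kato's two-body reduced resolvent `pairResolvent` and the one-cluster formula `interClusterKernel`
for `⟨κ'| V (E − H₀)⁻¹_red V |κ⟩` of two decoupled fermionic clusters, Tsai–Kivelson 2006 App. A)
and of `PlaquettePairCouplings.lean` (the `O(t'²)` pair-boson couplings `J, V, μ` of the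
checkerboard Hubbard model, where the invariance of these numbers under rephasing the chosen
plaquette states is recorded as "NOT proved here"). Everything below is PROVED; no named fact is
introduced.

* `pairResolvent` is sesquilinear in its four vector arguments (`pairResolvent_smul₁…₄`),
  symmetric under exchanging the two copies (`pairResolvent_swap`), has the BASIS-FREE
  spectral-projection form
  `Σ_{s,t ∈ σ(A)} ⟨a, P_s b⟩ ⟨c, P_t d⟩ / (s + t − E)` over Kato's eigenprojections
  `P_s = eigenProj A s` (`pairResolvent_eq_sum_eigenProj`; Kato 1966, I-§5.3 (5.32): the reduced
  resolvent is a function of the spectral projections, not of an eigenbasis), and is therefore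
  INVARIANT under any isometry commuting with `A` applied to all four vectors
  (`pairResolvent_mulVec_of_commute`).
* `interClusterKernel hH φ W` is GAUGE COVARIANT: rephasing the cluster states `φ_k ↦ u_k φ_k`,
  `|u_k| = 1`, multiplies the entry `(κ', κ)` by `ū_{κ'.1} ū_{κ'.2} u_{κ.1} u_{κ.2}`
  (`interClusterKernel_unitPhase`); in particular the diagonal entries (second-order shifts) and the
  exchange entries `((k,l),(l,k))` (correlated pair hoppings such as `J = −Re M((1,0),(0,1))`) are
  gauge INVARIANT (`interClusterKernel_unitPhase_diag`, `interClusterKernel_unitPhase_exchange`) —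
  the statement left unproved in `PlaquettePairCouplings.lean`.
* CLUSTER EXCHANGE: `M_W(κ', κ) = M_{Wᵀ}(κ'.swap, κ.swap)` (`interClusterKernel_swap`): relabelling
  which cluster is "1" transposes the hopping matrix and swaps the occupation labels.
* COVARIANCE UNDER SECOND-QUANTISED ORBITAL BIJECTIONS: if an isometry `Γ` commutes with `H` and
  intertwines the Jordan–Wigner operators along a bijection `f` of the orbitals
  (`Γ c_i = c_{f i} Γ`, `Γ c†_i = c†_{f i} Γ` — e.g. `Γ = fockMapOp f`, `FockMapOp.lean`), then
  `M_W[Γφ] = M_{W ∘ (f × f)}[φ]` (`interClusterKernel_mulVec_of_intertwine`,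
  `interClusterKernel_fockMapOp`); if moreover the cluster states are symmetry-adapted,
  `Γ φ_k = u_k φ_k`, the diagonal and exchange entries of `M_{W ∘ (f × f)}` and `M_W` COINCIDE
  (`interClusterKernel_comp_eq_of_eigenphase_diag/_exchange`). For the Hubbard Hamiltonian of a
  graph and a graph automorphism this is `interClusterKernel_hamiltonian_mapEquiv`.

These are the abstract halves of: the choice-independence of `plaquettePairCouplings` (given
nondegenerate sector ground states), the reflection symmetry `δE(1,0) = δE(0,1)` of the
two-plaquette shifts, the reality of the pair-hopping entry, and the equality of the couplings
across horizontal and vertical plaquette bonds (isotropy of the effective XXZ model) — all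
obtained WITHOUT the `B₁g`/`A₁` symmetry labels of the plaquette states, because each state
enters every relevant entry once as a bra and once as a ket.

## Mathlib / tree search

Mathlib: `Commute.cfc_real` (an element commuting with `a` commutes with `cfc f a`),
`Matrix.IsHermitian.eigenvectorUnitary`, `Finset.sum_fiberwise_of_maps_to`, `Equiv.sum_comp`.
Tree: `pairResolvent`, `interClusterKernel`, `eigenProj`, `star_interClusterKernel`
(`ClusterPairBosonCouplings`); `IsHermitian.cfc_eq_conj_diagonal` (`DuhamelTwoPoint`),
`star_eigenvectorUnitary_mulVec_apply`, `star_dotProduct_mulVec` (`TorusPairSusceptibility`);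
`fockMapOp_mul_annihilation`, `fockMapOp_mul_creation`, `conjTranspose_fockMapOp_mul_self`,
`fockMapOp_mapEquiv_mul_hamiltonian` (`FockMapOp`). `lean search 'pairResolvent|interClusterKernel'`:
only the two definition files and `PlaquettePairCouplings.lean`; no symmetry statements.

## References

* T. Kato, *Perturbation theory for linear operators* (1966), I-§5.3 (5.26)–(5.32) (eigenprojections
  and the reduced resolvent as functions of the operator). [Kato1966]
* W.-F. Tsai, S. A. Kivelson, PRB 73 (2006) 214510, App. A (A1)–(A3) (the two-plaquette
  second-order kernel). [TsaiKivelson2006]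
* H. Yao, W.-F. Tsai, S. A. Kivelson, PRB 76 (2007) 161104(R), eq. (2) and p. 2 (nondegenerate
  `d`-wave and `s`-wave plaquette states; isotropic boson model on the square superlattice).
  [YaoTsaiKivelson2007]
* O. Bratteli, D. W. Robinson, *Operator Algebras and QSM II*, §5.2.2, Thm. 5.2.5 (unitarily
  implemented one-particle symmetries). [BratteliRobinsonII1997]
-/

noncomputable section

namespace Literature.MathematicalPhysics.QuantumLattice

open Matrix Finset

/-! ### The pair resolvent: sesquilinearity, exchange symmetry, spectral-projection form -/

section PairResolvent

variable {n : Type*} [Fintype n] [DecidableEq n] {A : Matrix n n ℂ}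

/-- `pairResolvent` is conjugate-linear in its first argument. [folklore] -/
theorem pairResolvent_smul₁ (hA : A.IsHermitian) (E : ℝ) (x : ℂ) (a b c d : n → ℂ) :
    pairResolvent hA E (x • a) b c d = star x * pairResolvent hA E a b c d := by
  unfold pairResolvent
  rw [Finset.mul_sum]
  refine Finset.sum_congr rfl fun μ _ => ?_
  rw [Finset.mul_sum]
  refine Finset.sum_congr rfl fun ν _ => ?_
  rw [star_smul, smul_dotProduct, smul_eq_mul]
  ring

/-- `pairResolvent` is linear in its second argument. [folklore] -/
theorem pairResolvent_smul₂ (hA : A.IsHermitian) (E : ℝ) (x : ℂ) (a b c d : n → ℂ) :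
    pairResolvent hA E a (x • b) c d = x * pairResolvent hA E a b c d := by
  unfold pairResolvent
  rw [Finset.mul_sum]
  refine Finset.sum_congr rfl fun μ _ => ?_
  rw [Finset.mul_sum]
  refine Finset.sum_congr rfl fun ν _ => ?_
  rw [dotProduct_smul, smul_eq_mul]
  ring

/-- `pairResolvent` is conjugate-linear in its third argument. [folklore] -/
theorem pairResolvent_smul₃ (hA : A.IsHermitian) (E : ℝ) (x : ℂ) (a b c d : n → ℂ) :
    pairResolvent hA E a b (x • c) d = star x * pairResolvent hA E a b c d := by
  unfold pairResolvent
  rw [Finset.mul_sum]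
  refine Finset.sum_congr rfl fun μ _ => ?_
  rw [Finset.mul_sum]
  refine Finset.sum_congr rfl fun ν _ => ?_
  rw [star_smul, smul_dotProduct, smul_eq_mul]
  ring

/-- `pairResolvent` is linear in its fourth argument. [folklore] -/
theorem pairResolvent_smul₄ (hA : A.IsHermitian) (E : ℝ) (x : ℂ) (a b c d : n → ℂ) :
    pairResolvent hA E a b c (x • d) = x * pairResolvent hA E a b c d := by
  unfold pairResolvent
  rw [Finset.mul_sum]
  refine Finset.sum_congr rfl fun μ _ => ?_
  rw [Finset.mul_sum]
  refine Finset.sum_congr rfl fun ν _ => ?_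
  rw [dotProduct_smul, smul_eq_mul]
  ring

/-- **Exchange symmetry of the two copies**: `K(E; a,b; c,d) = K(E; c,d; a,b)` (the Kronecker sum
`A ⊗ 1 + 1 ⊗ A` is symmetric under the flip of the two factors). [folklore] -/
theorem pairResolvent_swap (hA : A.IsHermitian) (E : ℝ) (a b c d : n → ℂ) :
    pairResolvent hA E a b c d = pairResolvent hA E c d a b := by
  unfold pairResolvent
  rw [Finset.sum_comm]
  refine Finset.sum_congr rfl fun ν _ => Finset.sum_congr rfl fun μ _ => ?_
  rw [add_comm (hA.eigenvalues μ) (hA.eigenvalues ν)]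
  ring

/-- Matrix elements of a unitarily conjugated diagonal matrix between two vectors:
`⟨a, U diag(d) U⋆ b⟩ = Σ_i d_i · conj((U⋆a)_i) · (U⋆b)_i`. [folklore] -/
theorem star_dotProduct_conj_diagonal_mulVec₂ (U : Matrix n n ℂ) (d a b : n → ℂ) :
    star a ⬝ᵥ ((U * diagonal d * star U) *ᵥ b) =
      ∑ i, d i * (star ((star U *ᵥ a) i) * (star U *ᵥ b) i) := by
  have hw : star a ᵥ* U = star (star U *ᵥ a) := by
    rw [star_mulVec, star_eq_conjTranspose, conjTranspose_conjTranspose]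
  rw [← mulVec_mulVec, ← mulVec_mulVec, dotProduct_mulVec, hw]
  simp only [dotProduct, Pi.star_apply, mulVec_diagonal]
  exact Finset.sum_congr rfl fun i _ => by ring

/-- **Fibres of the eigenvalue map are eigenprojections**: for every real `s`,
`Σ_{μ : λ_μ = s} ⟨a, u_μ⟩⟨u_μ, b⟩ = ⟨a, P_s b⟩` with `P_s = eigenProj A s` Kato's eigenprojection
(the indicator of `{s}` in the functional calculus; `0` if `s` is not an eigenvalue).
[cite: Kato1966, I-§5.3 (5.26)] -/
theorem sum_ite_eigenvalues_eq_dotProduct_eigenProj (hA : A.IsHermitian) (s : ℝ) (a b : n → ℂ) :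
    ∑ μ, (if hA.eigenvalues μ = s then (1 : ℂ) else 0) *
        ((star a ⬝ᵥ ⇑(hA.eigenvectorBasis μ)) * (star ⇑(hA.eigenvectorBasis μ) ⬝ᵥ b)) =
      star a ⬝ᵥ (eigenProj A s *ᵥ b) := by
  rw [eigenProj, hA.cfc_eq_conj_diagonal, star_dotProduct_conj_diagonal_mulVec₂]
  refine Finset.sum_congr rfl fun μ _ => ?_
  rw [star_eigenvectorUnitary_mulVec_apply, star_eigenvectorUnitary_mulVec_apply, star_dotProduct]
  by_cases h : hA.eigenvalues μ = s
  · rw [if_pos h, if_pos h, Complex.ofReal_one]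
  · rw [if_neg h, if_neg h, Complex.ofReal_zero]

/-- The fibre sum in `Finset.filter` form. [cite: Kato1966, I-§5.3 (5.26)] -/
theorem sum_filter_eigenvalues_eq_dotProduct_eigenProj (hA : A.IsHermitian) (s : ℝ) (a b : n → ℂ) :
    ∑ μ ∈ univ.filter (fun μ => hA.eigenvalues μ = s),
        (star a ⬝ᵥ ⇑(hA.eigenvectorBasis μ)) * (star ⇑(hA.eigenvectorBasis μ) ⬝ᵥ b) =
      star a ⬝ᵥ (eigenProj A s *ᵥ b) := by
  rw [Finset.sum_filter, ← sum_ite_eigenvalues_eq_dotProduct_eigenProj hA s a b]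
  refine Finset.sum_congr rfl fun μ _ => ?_
  split_ifs <;> simp

/-- **Spectral-projection form of the pair resolvent** (basis-free): with `σ(A)` the finite set of
eigenvalues of `A` and `P_s = eigenProj A s`,
`K(E; a,b; c,d) = Σ_{s ∈ σ(A)} Σ_{t ∈ σ(A)} ⟨a, P_s b⟩ ⟨c, P_t d⟩ / (s + t − E)` (terms with
`s + t = E` dropped, `0⁻¹ = 0`): the matrix element of `Σ_{s+t≠E} (s+t−E)⁻¹ P_s ⊗ P_t`, Kato's
reduced resolvent of `A ⊗ 1 + 1 ⊗ A`, between `a ⊗ c` and `b ⊗ d`. In particular the value does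
not depend on the choice of eigenbasis. [cite: Kato1966, I-§5.3 (5.32)] -/
theorem pairResolvent_eq_sum_eigenProj (hA : A.IsHermitian) (E : ℝ) (a b c d : n → ℂ) :
    pairResolvent hA E a b c d =
      ∑ s ∈ univ.image hA.eigenvalues, ∑ t ∈ univ.image hA.eigenvalues,
        (star a ⬝ᵥ (eigenProj A s *ᵥ b)) * (star c ⬝ᵥ (eigenProj A t *ᵥ d)) *
          (((s + t - E : ℝ) : ℂ))⁻¹ := by
  have hmaps : ∀ μ ∈ (univ : Finset n), hA.eigenvalues μ ∈ univ.image hA.eigenvalues :=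
    fun μ _ => Finset.mem_image_of_mem _ (Finset.mem_univ μ)
  unfold pairResolvent
  rw [← Finset.sum_fiberwise_of_maps_to hmaps]
  refine Finset.sum_congr rfl fun s _ => ?_
  -- inner sum over `ν`, fibrewise
  have inner : ∀ μ ∈ univ.filter (fun μ => hA.eigenvalues μ = s),
      ∑ ν, (star a ⬝ᵥ ⇑(hA.eigenvectorBasis μ)) * (star ⇑(hA.eigenvectorBasis μ) ⬝ᵥ b) *
          ((star c ⬝ᵥ ⇑(hA.eigenvectorBasis ν)) * (star ⇑(hA.eigenvectorBasis ν) ⬝ᵥ d)) *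
            (((hA.eigenvalues μ + hA.eigenvalues ν - E : ℝ) : ℂ))⁻¹ =
        ∑ t ∈ univ.image hA.eigenvalues,
          (star a ⬝ᵥ ⇑(hA.eigenvectorBasis μ)) * (star ⇑(hA.eigenvectorBasis μ) ⬝ᵥ b) *
            ((star c ⬝ᵥ (eigenProj A t *ᵥ d)) * (((s + t - E : ℝ) : ℂ))⁻¹) := by
    intro μ hμ
    have hμs : hA.eigenvalues μ = s := (Finset.mem_filter.1 hμ).2
    rw [← Finset.sum_fiberwise_of_maps_to hmaps]
    refine Finset.sum_congr rfl fun t _ => ?_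
    rw [← sum_filter_eigenvalues_eq_dotProduct_eigenProj hA t c d, Finset.sum_mul, Finset.mul_sum]
    refine Finset.sum_congr rfl fun ν hν => ?_
    have hνt : hA.eigenvalues ν = t := (Finset.mem_filter.1 hν).2
    rw [hμs, hνt]
    ring
  rw [Finset.sum_congr rfl inner, Finset.sum_comm]
  refine Finset.sum_congr rfl fun t _ => ?_
  rw [← sum_filter_eigenvalues_eq_dotProduct_eigenProj hA s a b, Finset.sum_mul, Finset.sum_mul]
  refine Finset.sum_congr rfl fun μ _ => ?_
  ring

/-- An isometry preserves inner products of two vectors: `⟨Γ x, Γ y⟩ = ⟨x, y⟩` when `Γᴴ Γ = 1`.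
[folklore] -/
theorem star_isometry_mulVec_dotProduct_isometry_mulVec {Γ : Matrix n n ℂ} (hΓ : Γᴴ * Γ = 1)
    (x y : n → ℂ) : star (Γ *ᵥ x) ⬝ᵥ (Γ *ᵥ y) = star x ⬝ᵥ y := by
  rw [star_dotProduct_mulVec, mulVec_mulVec, hΓ, one_mulVec]

/-- Matrix elements of an operator commuting with an isometry `Γ` are `Γ`-invariant:
`⟨Γ x, P Γ y⟩ = ⟨x, P y⟩`. [folklore] -/
theorem star_isometry_mulVec_dotProduct_mulVec_of_commute {Γ P : Matrix n n ℂ} (hΓ : Γᴴ * Γ = 1)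
    (hP : Commute P Γ) (x y : n → ℂ) :
    star (Γ *ᵥ x) ⬝ᵥ (P *ᵥ (Γ *ᵥ y)) = star x ⬝ᵥ (P *ᵥ y) := by
  rw [mulVec_mulVec, hP.eq, ← mulVec_mulVec, star_isometry_mulVec_dotProduct_isometry_mulVec hΓ]

/-- Kato's eigenprojections commute with every matrix commuting with `A` (they are functions of
`A`). [cite: Kato1966, I-§5.3 (5.26)] -/
theorem commute_eigenProj_of_commute {Γ : Matrix n n ℂ} (hΓA : Commute Γ A) (s : ℝ) :
    Commute (eigenProj A s) Γ := by
  rw [eigenProj]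
  exact hΓA.symm.cfc_real _

/-- **Invariance of the pair resolvent under symmetries of `A`**: if `Γ` is an isometry commuting
with `A` then `K(E; Γa, Γb; Γc, Γd) = K(E; a,b; c,d)` (the reduced resolvent of
`A ⊗ 1 + 1 ⊗ A` commutes with `Γ ⊗ Γ`). [cite: Kato1966, I-§5.3 (5.32)] -/
theorem pairResolvent_mulVec_of_commute (hA : A.IsHermitian) (E : ℝ) {Γ : Matrix n n ℂ}
    (hΓ : Γᴴ * Γ = 1) (hΓA : Commute Γ A) (a b c d : n → ℂ) :
    pairResolvent hA E (Γ *ᵥ a) (Γ *ᵥ b) (Γ *ᵥ c) (Γ *ᵥ d) = pairResolvent hA E a b c d := by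
  rw [pairResolvent_eq_sum_eigenProj, pairResolvent_eq_sum_eigenProj]
  refine Finset.sum_congr rfl fun s _ => Finset.sum_congr rfl fun t _ => ?_
  rw [star_isometry_mulVec_dotProduct_mulVec_of_commute hΓ (commute_eigenProj_of_commute hΓA s),
    star_isometry_mulVec_dotProduct_mulVec_of_commute hΓ (commute_eigenProj_of_commute hΓA t)]

end PairResolvent

/-! ### Gauge covariance and cluster exchange of the inter-cluster kernel -/

section InterCluster

variable {ι : Type*} [LinearOrder ι] [Fintype ι] {K : Type*}
  {H : Matrix (Finset ι) (Finset ι) ℂ}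

/-- The eigenvalue of an isometry on a normalised vector is unimodular: `Γᴴ Γ = 1`, `⟨φ, φ⟩ = 1`,
`Γ φ = a φ ⇒ ā a = 1`. [folklore] -/
theorem star_mul_self_eq_one_of_isometry_mulVec_eq_smul {Γ : Matrix (Finset ι) (Finset ι) ℂ}
    (hΓ : Γᴴ * Γ = 1) {φ : Fock ι} (hφ : star φ ⬝ᵥ φ = 1) {a : ℂ} (ha : Γ *ᵥ φ = a • φ) :
    star a * a = 1 := by
  have h := star_isometry_mulVec_dotProduct_isometry_mulVec hΓ φ φ
  rw [ha, star_smul, smul_dotProduct, dotProduct_smul, hφ, smul_eq_mul, smul_eq_mul, mul_one] at h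
  exact h

omit [LinearOrder ι] in
/-- Rephasing the cluster states by unit complex numbers does not change the unperturbed pair
energies. [folklore] -/
theorem pairEnergy_unitPhase (H : Matrix (Finset ι) (Finset ι) ℂ) (φ : K → Fock ι) (u : K → ℂ)
    (hu : ∀ k, star (u k) * u k = 1) (κ : K × K) :
    pairEnergy H (fun k => u k • φ k) κ = pairEnergy H φ κ := by
  -- `⟨uψ, H uψ⟩ = ū u ⟨ψ, H ψ⟩ = ⟨ψ, H ψ⟩`
  have h : ∀ k, expect H (u k • φ k) = expect H (φ k) := by
    intro k
    simp only [expect, mulVec_smul, star_smul, smul_dotProduct, dotProduct_smul, smul_eq_mul,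
      ← mul_assoc, mul_comm (u k) (star (u k)), hu k, one_mul]
  simp only [pairEnergy, h]

/-- **Gauge covariance of the inter-cluster kernel.** Rephasing the cluster states,
`φ_k ↦ u_k φ_k` with `ū_k u_k = 1`, multiplies the entry `(κ', κ)` of
`interClusterKernel hH φ W` by `ū_{κ'.1} ū_{κ'.2} u_{κ.1} u_{κ.2}`: in each of the four
second-order processes the bra states are `φ_{κ'.1}, φ_{κ'.2}` and the ket states
`φ_{κ.1}, φ_{κ.2}`. [cite: TsaiKivelson2006, App. A (A1)] -/
theorem interClusterKernel_unitPhase (hH : H.IsHermitian) (φ : K → Fock ι) (W : ι → ι → ℝ)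
    (u : K → ℂ) (hu : ∀ k, star (u k) * u k = 1) (κ' κ : K × K) :
    interClusterKernel hH (fun k => u k • φ k) W κ' κ =
      star (u κ'.1) * star (u κ'.2) * u κ.1 * u κ.2 * interClusterKernel hH φ W κ' κ := by
  unfold interClusterKernel
  rw [pairEnergy_unitPhase H φ u hu, pairEnergy_unitPhase H φ u hu]
  simp only [mulVec_smul, pairResolvent_smul₁, pairResolvent_smul₂, pairResolvent_smul₃,
    pairResolvent_smul₄]
  rw [Finset.mul_sum]
  refine Finset.sum_congr rfl fun i _ => ?_
  rw [Finset.mul_sum]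
  refine Finset.sum_congr rfl fun j _ => ?_
  rw [Finset.mul_sum]
  refine Finset.sum_congr rfl fun i' _ => ?_
  rw [Finset.mul_sum]
  refine Finset.sum_congr rfl fun j' _ => ?_
  ring

/-- The gauge phase of a DIAGONAL entry is `1`: the second-order shifts `Re M(κ, κ)` are gauge
invariant. [cite: TsaiKivelson2006, App. A (A1)] -/
theorem interClusterKernel_unitPhase_diag (hH : H.IsHermitian) (φ : K → Fock ι) (W : ι → ι → ℝ)
    (u : K → ℂ) (hu : ∀ k, star (u k) * u k = 1) (κ : K × K) :
    interClusterKernel hH (fun k => u k • φ k) W κ κ = interClusterKernel hH φ W κ κ := by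
  rw [interClusterKernel_unitPhase hH φ W u hu,
    show star (u κ.1) * star (u κ.2) * u κ.1 * u κ.2 = (star (u κ.1) * u κ.1) * (star (u κ.2) * u κ.2)
      by ring, hu, hu, one_mul, one_mul]

/-- The gauge phase of an EXCHANGE entry `((k,l),(l,k))` is `1`: correlated pair-hopping
amplitudes such as `J = −Re M((1,0),(0,1))` are gauge invariant (each cluster state enters once
as a bra and once as a ket). [cite: YaoTsaiKivelson2007, eq. (2)] -/
theorem interClusterKernel_unitPhase_exchange (hH : H.IsHermitian) (φ : K → Fock ι)
    (W : ι → ι → ℝ) (u : K → ℂ) (hu : ∀ k, star (u k) * u k = 1) (k l : K) :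
    interClusterKernel hH (fun k => u k • φ k) W (k, l) (l, k) =
      interClusterKernel hH φ W (k, l) (l, k) := by
  rw [interClusterKernel_unitPhase hH φ W u hu,
    show star (u (k, l).1) * star (u (k, l).2) * u (l, k).1 * u (l, k).2 =
      (star (u k) * u k) * (star (u l) * u l) by simp only; ring, hu, hu, one_mul, one_mul]

omit [LinearOrder ι] in
/-- The unperturbed pair energy is symmetric under exchanging the two clusters. [folklore] -/
theorem pairEnergy_swap (H : Matrix (Finset ι) (Finset ι) ℂ) (φ : K → Fock ι) (κ : K × K) :
    pairEnergy H φ κ.swap = pairEnergy H φ κ := by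
  simp only [pairEnergy, Prod.fst_swap, Prod.snd_swap, add_comm]

/-- **Cluster exchange.** Declaring cluster 2 to be "cluster 1" transposes the inter-cluster
hopping matrix and swaps the occupation labels:
`M_{Wᵀ}(κ'.swap, κ.swap) = M_W(κ', κ)` — the four second-order processes are permuted among
themselves (pair transfer `1 → 2` ↔ `2 → 1`, and the two out-and-back processes), using the
exchange symmetry of the pair resolvent. [cite: TsaiKivelson2006, App. A (A1)–(A3)] -/
theorem interClusterKernel_swap (hH : H.IsHermitian) (φ : K → Fock ι) (W : ι → ι → ℝ)
    (κ' κ : K × K) :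
    interClusterKernel hH φ (fun i j => W j i) κ'.swap κ.swap = interClusterKernel hH φ W κ' κ := by
  -- renaming `(i, j, i', j') ↦ (j, i, j', i')` of a quadruple sum
  have key : ∀ F : ι → ι → ι → ι → ℂ,
      ∑ i, ∑ j, ∑ i', ∑ j', F i j i' j' = ∑ i, ∑ j, ∑ i', ∑ j', F j i j' i' := by
    intro F
    calc ∑ i, ∑ j, ∑ i', ∑ j', F i j i' j' = ∑ j, ∑ i, ∑ i', ∑ j', F i j i' j' := Finset.sum_comm
      _ = ∑ j, ∑ i, ∑ j', ∑ i', F i j i' j' :=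
          Finset.sum_congr rfl fun j _ => Finset.sum_congr rfl fun i _ => Finset.sum_comm
  unfold interClusterKernel
  rw [key]
  simp only [Prod.fst_swap, Prod.snd_swap, pairEnergy_swap]
  refine Finset.sum_congr rfl fun i _ => Finset.sum_congr rfl fun j _ =>
    Finset.sum_congr rfl fun i' _ => Finset.sum_congr rfl fun j' _ => ?_
  rw [pairResolvent_swap hH _ (creation j' *ᵥ φ κ'.2) (annihilation j *ᵥ φ κ.2),
    pairResolvent_swap hH _ (annihilation j' *ᵥ φ κ'.2) (creation j *ᵥ φ κ.2),
    pairResolvent_swap hH _ (annihilation j' *ᵥ φ κ'.2) (annihilation j *ᵥ φ κ.2),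
    pairResolvent_swap hH _ (creation j' *ᵥ φ κ'.2) (creation j *ᵥ φ κ.2)]
  ring

/-- The diagonal shifts of mirror-image product states agree after transposing the bond set:
`M_{Wᵀ}((l,k),(l,k)) = M_W((k,l),(k,l))`. [cite: TsaiKivelson2006, App. A (A1)] -/
theorem interClusterKernel_swap_diag (hH : H.IsHermitian) (φ : K → Fock ι) (W : ι → ι → ℝ)
    (k l : K) :
    interClusterKernel hH φ (fun i j => W j i) (l, k) (l, k) =
      interClusterKernel hH φ W (k, l) (k, l) :=
  interClusterKernel_swap hH φ W (k, l) (k, l)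

/-- For an exchange entry the cluster exchange is the Hermitian conjugate:
`M_{Wᵀ}((k,l),(l,k)) = M_W((l,k),(k,l)) = conj M_W((k,l),(l,k))`. [cite: TsaiKivelson2006, App. A (A1)] -/
theorem interClusterKernel_swap_exchange (hH : H.IsHermitian) (φ : K → Fock ι) (W : ι → ι → ℝ)
    (k l : K) :
    interClusterKernel hH φ (fun i j => W j i) (k, l) (l, k) =
      star (interClusterKernel hH φ W (k, l) (l, k)) := by
  rw [star_interClusterKernel]
  exact interClusterKernel_swap hH φ W (l, k) (k, l)

/-! ### Covariance under second-quantised orbital bijections -/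

/-- Expectation values are invariant under an isometry commuting with the observable.
[folklore] -/
theorem expect_isometry_mulVec {Γ A : Matrix (Finset ι) (Finset ι) ℂ} (hΓ : Γᴴ * Γ = 1)
    (hΓA : Commute Γ A) (ψ : Fock ι) : expect A (Γ *ᵥ ψ) = expect A ψ := by
  unfold expect
  exact star_isometry_mulVec_dotProduct_mulVec_of_commute hΓ hΓA.symm ψ ψ

/-- The unperturbed pair energies are invariant under an isometry commuting with `H`.
[folklore] -/
theorem pairEnergy_isometry_mulVec (H : Matrix (Finset ι) (Finset ι) ℂ) (φ : K → Fock ι)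
    {Γ : Matrix (Finset ι) (Finset ι) ℂ} (hΓ : Γᴴ * Γ = 1) (hΓH : Commute Γ H) (κ : K × K) :
    pairEnergy H (fun k => Γ *ᵥ φ k) κ = pairEnergy H φ κ := by
  simp only [pairEnergy, expect_isometry_mulVec hΓ hΓH]

/-- **Covariance of the inter-cluster kernel under a second-quantised orbital bijection.** Let the
isometry `Γ` commute with the cluster Hamiltonian `H` and intertwine the Jordan–Wigner operators
along a bijection `f` of the orbitals, `Γ c_i = c_{f i} Γ`, `Γ c†_i = c†_{f i} Γ` (a unitarily
implemented one-particle symmetry, Bratteli–Robinson II Thm. 5.2.5; e.g. `Γ = fockMapOp f`). Then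
transforming the cluster states is the same as pulling the hopping matrix back along `f`:
`M_W[Γφ](κ', κ) = M_{W ∘ (f × f)}[φ](κ', κ)`. [cite: BratteliRobinsonII1997, §5.2.2, Thm. 5.2.5] -/
theorem interClusterKernel_mulVec_of_intertwine (hH : H.IsHermitian) (φ : K → Fock ι)
    (W : ι → ι → ℝ) {Γ : Matrix (Finset ι) (Finset ι) ℂ} (hΓ : Γᴴ * Γ = 1) (hΓH : Commute Γ H)
    (f : ι ≃ ι) (hann : ∀ i, Γ * annihilation i = annihilation (f i) * Γ)
    (hcre : ∀ i, Γ * creation i = creation (f i) * Γ) (κ' κ : K × K) :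
    interClusterKernel hH (fun k => Γ *ᵥ φ k) W κ' κ =
      interClusterKernel hH φ (fun i j => W (f i) (f j)) κ' κ := by
  have hca : ∀ (i : ι) (ψ : Fock ι), annihilation (f i) *ᵥ (Γ *ᵥ ψ) = Γ *ᵥ (annihilation i *ᵥ ψ) := by
    intro i ψ
    rw [mulVec_mulVec, ← hann, ← mulVec_mulVec]
  have hcc : ∀ (i : ι) (ψ : Fock ι), creation (f i) *ᵥ (Γ *ᵥ ψ) = Γ *ᵥ (creation i *ᵥ ψ) := by
    intro i ψ
    rw [mulVec_mulVec, ← hcre, ← mulVec_mulVec]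
  unfold interClusterKernel
  rw [pairEnergy_isometry_mulVec H φ hΓ hΓH, pairEnergy_isometry_mulVec H φ hΓ hΓH]
  rw [← Equiv.sum_comp f]
  refine Finset.sum_congr rfl fun i _ => ?_
  rw [← Equiv.sum_comp f]
  refine Finset.sum_congr rfl fun j _ => ?_
  rw [← Equiv.sum_comp f]
  refine Finset.sum_congr rfl fun i' _ => ?_
  rw [← Equiv.sum_comp f]
  refine Finset.sum_congr rfl fun j' _ => ?_
  simp only [hca, hcc, pairResolvent_mulVec_of_commute hH _ hΓ hΓH]

/-- **Covariance under `fockMapOp`**: for an orbital bijection `e` whose second quantisation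
`Γ(e) = fockMapOp e` commutes with the cluster Hamiltonian,
`M_W[Γ(e)φ] = M_{W ∘ (e × e)}[φ]`. [cite: BratteliRobinsonII1997, §5.2.2, Thm. 5.2.5] -/
theorem interClusterKernel_fockMapOp (hH : H.IsHermitian) (φ : K → Fock ι) (W : ι → ι → ℝ)
    (e : ι ≃ ι) (hcomm : Commute (fockMapOp e) H) (κ' κ : K × K) :
    interClusterKernel hH (fun k => fockMapOp e *ᵥ φ k) W κ' κ =
      interClusterKernel hH φ (fun i j => W (e i) (e j)) κ' κ :=
  interClusterKernel_mulVec_of_intertwine hH φ W (conjTranspose_fockMapOp_mul_self _ e.injective)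
    hcomm e (fun i => fockMapOp_mul_annihilation _ e.bijective i)
    (fun i => fockMapOp_mul_creation _ i) κ' κ

/-- **Symmetry-adapted cluster states.** If, in the situation of
`interClusterKernel_mulVec_of_intertwine`, every cluster state is an eigenvector of the symmetry,
`Γ φ_k = u_k φ_k` (`ū_k u_k = 1`; automatic for nondegenerate sector ground states of a
symmetric `H`), then pulling the hopping matrix back along `f` only produces the gauge phase:
`M_{W ∘ (f × f)}(κ', κ) = ū_{κ'.1} ū_{κ'.2} u_{κ.1} u_{κ.2} · M_W(κ', κ)`.
[cite: YaoTsaiKivelson2007, p. 2 (nondegenerate plaquette states)] -/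
theorem interClusterKernel_comp_of_eigenphase (hH : H.IsHermitian) (φ : K → Fock ι)
    (W : ι → ι → ℝ) {Γ : Matrix (Finset ι) (Finset ι) ℂ} (hΓ : Γᴴ * Γ = 1) (hΓH : Commute Γ H)
    (f : ι ≃ ι) (hann : ∀ i, Γ * annihilation i = annihilation (f i) * Γ)
    (hcre : ∀ i, Γ * creation i = creation (f i) * Γ) (u : K → ℂ)
    (hu : ∀ k, star (u k) * u k = 1) (hφ : ∀ k, Γ *ᵥ φ k = u k • φ k) (κ' κ : K × K) :
    interClusterKernel hH φ (fun i j => W (f i) (f j)) κ' κ =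
      star (u κ'.1) * star (u κ'.2) * u κ.1 * u κ.2 * interClusterKernel hH φ W κ' κ := by
  rw [← interClusterKernel_mulVec_of_intertwine hH φ W hΓ hΓH f hann hcre,
    show (fun k => Γ *ᵥ φ k) = fun k => u k • φ k from funext hφ,
    interClusterKernel_unitPhase hH φ W u hu]

/-- Symmetry-adapted states, DIAGONAL entries: the second-order shifts are invariant under pulling
the bonds back along the symmetry, `M_{W ∘ (f × f)}(κ, κ) = M_W(κ, κ)`.
[cite: YaoTsaiKivelson2007, p. 2 (nondegenerate plaquette states)] -/
theorem interClusterKernel_comp_eq_of_eigenphase_diag (hH : H.IsHermitian) (φ : K → Fock ι)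
    (W : ι → ι → ℝ) {Γ : Matrix (Finset ι) (Finset ι) ℂ} (hΓ : Γᴴ * Γ = 1) (hΓH : Commute Γ H)
    (f : ι ≃ ι) (hann : ∀ i, Γ * annihilation i = annihilation (f i) * Γ)
    (hcre : ∀ i, Γ * creation i = creation (f i) * Γ) (u : K → ℂ)
    (hu : ∀ k, star (u k) * u k = 1) (hφ : ∀ k, Γ *ᵥ φ k = u k • φ k) (κ : K × K) :
    interClusterKernel hH φ (fun i j => W (f i) (f j)) κ κ = interClusterKernel hH φ W κ κ := by
  rw [interClusterKernel_comp_of_eigenphase hH φ W hΓ hΓH f hann hcre u hu hφ,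
    show star (u κ.1) * star (u κ.2) * u κ.1 * u κ.2 = (star (u κ.1) * u κ.1) * (star (u κ.2) * u κ.2)
      by ring, hu, hu, one_mul, one_mul]

/-- Symmetry-adapted states, EXCHANGE entries: correlated pair-hopping amplitudes are invariant
under pulling the bonds back along the symmetry, `M_{W ∘ (f × f)}((k,l),(l,k)) = M_W((k,l),(l,k))`.
[cite: YaoTsaiKivelson2007, eq. (2)] -/
theorem interClusterKernel_comp_eq_of_eigenphase_exchange (hH : H.IsHermitian) (φ : K → Fock ι)
    (W : ι → ι → ℝ) {Γ : Matrix (Finset ι) (Finset ι) ℂ} (hΓ : Γᴴ * Γ = 1) (hΓH : Commute Γ H)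
    (f : ι ≃ ι) (hann : ∀ i, Γ * annihilation i = annihilation (f i) * Γ)
    (hcre : ∀ i, Γ * creation i = creation (f i) * Γ) (u : K → ℂ)
    (hu : ∀ k, star (u k) * u k = 1) (hφ : ∀ k, Γ *ᵥ φ k = u k • φ k) (k l : K) :
    interClusterKernel hH φ (fun i j => W (f i) (f j)) (k, l) (l, k) =
      interClusterKernel hH φ W (k, l) (l, k) := by
  rw [interClusterKernel_comp_of_eigenphase hH φ W hΓ hΓH f hann hcre u hu hφ,
    show star (u (k, l).1) * star (u (k, l).2) * u (l, k).1 * u (l, k).2 =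
      (star (u k) * u k) * (star (u l) * u l) by simp only; ring, hu, hu, one_mul, one_mul]

end InterCluster

/-! ### The Hubbard cluster: graph automorphisms -/

section Hubbard

open HubbardWave0

variable {Λ : Type*} [LinearOrder Λ] [Fintype Λ] {K : Type*}

/-- **Lattice symmetries of a Hubbard cluster act on the pair-boson kernel by relabelling the
bonds.** For a graph automorphism `g` of the cluster graph `G`, the second quantisation
`Γ_g = fockMapOp (Orb.mapEquiv g)` commutes with `hamiltonian G t U` (`FockMapOp.lean`), so
`M_W[Γ_g φ] = M_{W ∘ (g × g)}[φ]` for every set of cluster states and every inter-cluster hopping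
matrix `W` on the orbitals. [cite: EsslerEtAl2005, §2.2.2] -/
theorem interClusterKernel_hamiltonian_mapEquiv (G : SimpleGraph Λ) [DecidableRel G.Adj] (t U : ℝ)
    (hH : (hamiltonian G t U).IsHermitian) (g : Λ ≃ Λ) (hG : ∀ x y, G.Adj (g x) (g y) ↔ G.Adj x y)
    (φ : K → Fock (Orb Λ)) (W : Orb Λ → Orb Λ → ℝ) (κ' κ : K × K) :
    interClusterKernel hH (fun k => fockMapOp (Orb.mapEquiv g) *ᵥ φ k) W κ' κ =
      interClusterKernel hH φ (fun i j => W (Orb.mapEquiv g i) (Orb.mapEquiv g j)) κ' κ :=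
  interClusterKernel_fockMapOp hH φ W (Orb.mapEquiv g)
    (fockMapOp_mapEquiv_mul_hamiltonian G G g hG t U) κ' κ

omit [Fintype Λ] in
/-- The spin-diagonal bond hopping pulled back along a site bijection `g` is the bond hopping of
the pulled-back bond set: `W_B (g p, σ) (g q, σ') = W_{(g×g)⁻¹ B} (p,σ) (q,σ')`. [folklore] -/
theorem bondHopping_mapEquiv (B : Finset (Λ × Λ)) (g : Λ ≃ Λ) (i j : Orb Λ) :
    bondHopping B (Orb.mapEquiv g i) (Orb.mapEquiv g j) =
      bondHopping (B.map (g.prodCongr g).symm.toEmbedding) i j := by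
  unfold bondHopping
  have h1 : (ofLex (Orb.mapEquiv g i)).1 = g (ofLex i).1 := rfl
  have h2 : (ofLex (Orb.mapEquiv g i)).2 = (ofLex i).2 := rfl
  have h3 : (ofLex (Orb.mapEquiv g j)).1 = g (ofLex j).1 := rfl
  have h4 : (ofLex (Orb.mapEquiv g j)).2 = (ofLex j).2 := rfl
  rw [h1, h2, h3, h4]
  congr 1
  refine propext (and_congr_right fun _ => ?_)
  rw [Finset.mem_map_equiv]
  simp [Equiv.prodCongr_apply]

omit [Fintype Λ] in
/-- Exchanging the two orbital arguments of the spin-diagonal bond hopping transposes the bond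
set: `W_B (q,σ') (p,σ) = W_{Bᵀ} (p,σ) (q,σ')`, `Bᵀ = {(q,p) : (p,q) ∈ B}`. [folklore] -/
theorem bondHopping_swap (B : Finset (Λ × Λ)) (i j : Orb Λ) :
    bondHopping B j i = bondHopping (B.map (Equiv.prodComm Λ Λ).toEmbedding) i j := by
  unfold bondHopping
  have h : ((ofLex i).1, (ofLex j).1) ∈ B.map (Equiv.prodComm Λ Λ).toEmbedding ↔
      ((ofLex j).1, (ofLex i).1) ∈ B := by
    rw [Finset.mem_map_equiv, Equiv.prodComm_symm, Equiv.prodComm_apply, Prod.swap_prod_mk]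
  simp only [h, eq_comm]

end Hubbard

end Literature.MathematicalPhysics.QuantumLattice

end
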